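import Summits.NavierStokesRegularity.FluidComputer.LevelFluxFloor
import Summits.NavierStokesRegularity.FluidComputer.FrontResidenceCost
import HarnessLib

/-!
# Fluid computer — L16′: the FORWARD-FLUX FLOOR of a blow-up (a realised blow-up is a forward cascade in every terminal window)

HONEST FRAMING (cell `pub-fluidc`, verbatim): *low prior, high value-of-information experiment on Tao's
machine paradigm; NOT a claim that NS blows up.* Theorem side of the cell (necessities every cascade design must
respect); nothing here is evidence of blow-up, and nothing is said about any fixed finite set of levels.

* `forward_flux_floor` (**L16′ — THE FORWARD-FLUX FLOOR OF A BLOW-UP**) — there is an absolute `κ > 0` such that for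
  every maximal smooth solution `(u, p)` on `ℝ³ × [0,T)` (`ν > 0`), Leray–Hopf from `u 0`, and every `t₀ ∈ (0, T)`: at
  INFINITELY MANY levels `q` there are a band `{q, …, q+N−1}` and a time `t₁ ∈ (t₀, T)` with
  `κ ν³ ≤ ‖u(0)‖₂ · 2^{3q/2} · ∫_{t₀}^{t₁} Π_{q..q+N-1}(u(τ)) dτ`, `Π_B = −∑_{j∈B} N_j` the band flux of `LevelFluxFloor` — in
  every terminal window the NET energy flux into some band of high levels is POSITIVE (FORWARD) and at least
  `κ ν³ 2^{-3q/2}/‖u₀‖₂`, infinitely often up the ladder. Proof: the amplitude × spectral-tail floor L15′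
  (`FrontResidenceCost.amplitude_tail_floor`: `c³ν² < C_B² U_q Tail_q` i.o.), the energy bound `U_q ≤ C 2^{3q/2} ‖u₀‖₂`,
  truncation of the tail to a finite band and a window `[t₀, t₁]` (monotone convergence), L16 (`band_flux_ge`: band flux
  ≥ band rent − band stock), and the stock bound `∑_{k<N} ‖Δ̇_{q+k} u(t₀)‖₂² ≤ 4^{-q} F(u(t₀))` (`F = ∑_l 4^l ‖Δ̇_l u‖₂² < ∞`
  at the interior time `t₀`), negligible against `2^{-3q/2}` for large `q`. Degenerate Littlewood–Paley constants are
  excluded inside the proof by the strict inequality of L15′. Cascade reading: a realised blow-up is a FORWARD CASCADE in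
  every terminal window — not merely "high levels get populated" (L6/L12) but "the signed flux through the ladder into
  the tail is bounded below by an explicit power of the level", the necessity against which an atlas's measured
  shell-transfer / flux rows are read. Necessity only; nothing about sufficiency.

* `exists_bandFlux_gt` (**L16″**, appended) — hence the INSTANTANEOUS band flux exceeds `κν³2^{-3q/2}/(‖u₀‖₂(T − t₀))` at
  some time of every terminal window `(t₀, T)`, for infinitely many `q`: the forward flux into the high bands diverges at
  least like `(T − t₀)^{-1}` as the window closes on the singular time.

0 sorry; no new definitions, no named facts (inputs: `LevelFluxFloor.band_flux_ge` and its bookkeeping lemmas,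
`FrontResidenceCost.amplitude_tail_floor`, `BlockEnergyTransport.isSmoothL2Field_slice_of_maximal`, `LPBounds.reverse`).

## References

* A. Cheskidov, P. Constantin, S. Friedlander, R. Shvydkoy, *Energy conservation and Onsager's conjecture for the Euler
  equations*, Nonlinearity 21 (2008) 1233–1252 (Littlewood–Paley energy flux). [CCFS2008]
* A. Cheskidov, R. Shvydkoy, Arch. Ration. Mech. Anal. 195 (2010) 159–169, Lemma 3.2 (proof, (8)). [CheskidovShvydkoy2010]
* A. Cheskidov, M. Dai, arXiv:1507.06611 = Proc. Edinburgh Math. Soc. (2025), Thm. 1.1. [CheskidovDai2015]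
-/

noncomputable section

open MeasureTheory Set Function Filter Topology
open scoped ENNReal NNReal RealInnerProductSpace
open Literature.Analysis.FluidPDE Literature.Analysis.FunctionSpaces
open Literature.Analysis.FluidPDE.LPBounds (gradSq)
open Summit.NavierStokesRegularity.FluidComputer.BlockEnergyTransport
open Summit.NavierStokesRegularity.FluidComputer.BlockEnergyIdentity
open Summit.NavierStokesRegularity.FluidComputer.LevelFluxFloor

namespace Summit.NavierStokesRegularity.FluidComputer.ForwardFluxFloor

/-! ## L16′ — the forward-flux floor -/

/-- **L16′ — THE FORWARD-FLUX FLOOR OF A BLOW-UP.** There is an absolute `κ > 0` such that for every `ν > 0`, `T > 0`,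
every maximal smooth solution `(u, p)` of the unforced Navier–Stokes system on `ℝ³ × [0, T)` which is Leray–Hopf from
`u 0` (finite energy, finite lifespan), and every interior time `t₀ ∈ (0, T)`: at INFINITELY MANY levels `q` there are a
finite band of levels `q, q+1, …, q+N−1` and a time `t₁ ∈ (t₀, T)` such that the NET ENERGY FLUX INTO THE BAND over
`[t₀, t₁]`, `∫_{t₀}^{t₁} Π(τ) dτ = −∑_{k<N} ∫_{t₀}^{t₁} N_{q+k}(u(τ)) dτ`, satisfies
`κ ν³ ≤ ‖u(0)‖₂ · 2^{3q/2} · ∫_{t₀}^{t₁} Π(τ) dτ` (with `2^{3q/2} = 2^q √(2^q)`): the flux is POSITIVE — FORWARD — and at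
least `κ ν³ 2^{-3q/2}/‖u₀‖₂`. Proof: L15′ (`amplitude_tail_floor`: `c³ν² < C_B² U_q Tail_q` i.o.) with
`U_q ≤ C 2^{3q/2}‖u₀‖₂` bounds the tail enstrophy-time from below; monotone convergence truncates it to a finite band and a
window `[t₀, t₁]`; L16 converts band energy-time into band flux plus band stock; the stock of a high band at the interior
time `t₀` is `≤ 4^{-q} F(u(t₀))`, negligible against `2^{-3q/2}` for large `q`. Cascade reading: a realised blow-up is a
FORWARD CASCADE in every terminal window, with a signed flux into the high bands bounded below by an explicit power of
the level — the necessity against which measured shell-transfer / flux rows of a design are read. Necessity only;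
nothing about sufficiency or about any fixed finite set of levels. [cite: CheskidovShvydkoy2010, Lemma 3.2 (proof, (8))] -/
theorem forward_flux_floor :
    ∃ κ : ℝ, 0 < κ ∧ ∀ (ν T : ℝ), 0 < ν → 0 < T →
      ∀ (u : ℝ → EuclideanSpace ℝ (Fin 3) → EuclideanSpace ℝ (Fin 3)) (p : ℝ → EuclideanSpace ℝ (Fin 3) → ℝ),
      IsMaximalSmoothSolution ν 0 u p T → IsLerayHopfOn T ν 0 (u 0) u →
      ∀ t₀ ∈ Ioo 0 T, ∃ᶠ q : ℕ in atTop, ∃ (N : ℕ) (t₁ : ℝ), t₁ ∈ Ioo t₀ T ∧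
        κ * ν ^ 3 ≤ (eLpNorm (u 0) 2 volume).toReal * ((2 : ℝ) ^ q * Real.sqrt ((2 : ℝ) ^ q)) *
          -∑ k ∈ Finset.range N, (∫ τ in t₀..t₁,
            ∫ x, ⟪blockFn ((q + k : ℕ) : ℤ) (u τ) x, blockFn ((q + k : ℕ) : ℤ) (convect (u τ) (u τ)) x⟫) := by
  classical
  obtain ⟨c, CB, hc, hCB, Hat⟩ := FrontResidenceCost.amplitude_tail_floor
  obtain ⟨C₁, hC₁⟩ := exists_iSup_blockSup_le_energy
  set cr : ℝ := ((lpBounds (Fin 3)).Cr : ℝ) with hcrdef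
  have hcbpos : 0 < (CB : ℝ) := NNReal.coe_pos.2 (pos_iff_ne_zero.2 hCB)
  set κ : ℝ := c ^ 3 / (6 * (cr ^ 2 + 1) * (CB : ℝ) ^ 2 * ((C₁ : ℝ) + 1)) with hκ
  have hκpos : 0 < κ := by positivity
  refine ⟨κ, hκpos, fun ν T hν hT u p hmax hLH t₀ ht₀ => ?_⟩
  set K := lpBounds (Fin 3) with hK
  -- finiteness data: energy of the datum and the dyadic `Ḣ¹` size at the interior time `t₀`
  set E₀ : ℝ≥0∞ := eLpNorm (u 0) 2 volume with hE₀
  have hE₀top : E₀ ≠ ∞ := (hLH.memLp 0 ⟨le_rfl, hT.le⟩).eLpNorm_ne_top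
  set F : ℝ≥0∞ := dyadicF (u t₀) with hF
  have hFtop : F ≠ ∞ := dyadicF_ne_top (isSmoothL2Field_slice_of_maximal hν hT hmax hLH ht₀)
  -- eventually in `q`: the stock constant is dominated, `F E₀ ≤ κ ν³ √(2^q)`
  set Bst : ℝ := F.toReal * E₀.toReal with hBst
  have hBst0 : 0 ≤ Bst := mul_nonneg ENNReal.toReal_nonneg ENNReal.toReal_nonneg
  have hκν : 0 < κ * ν ^ 3 := by positivity
  have hev : ∀ᶠ q : ℕ in atTop, Bst ≤ κ * ν ^ 3 * Real.sqrt ((2 : ℝ) ^ q) := by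
    set r : ℝ := Bst / (κ * ν ^ 3) with hr
    have hr0 : 0 ≤ r := div_nonneg hBst0 hκν.le
    refine (eventually_ge_atTop ⌈r ^ 2⌉₊).mono fun q hq => ?_
    have h1 : r ^ 2 ≤ (q : ℝ) := (Nat.le_ceil _).trans (by exact_mod_cast hq)
    have h2 : (q : ℝ) ≤ (2 : ℝ) ^ q := by exact_mod_cast (Nat.lt_two_pow_self).le
    have h3 : r ≤ Real.sqrt ((2 : ℝ) ^ q) := by
      rw [← Real.sqrt_sq hr0]
      exact Real.sqrt_le_sqrt (h1.trans h2)
    calc Bst = κ * ν ^ 3 * r := by rw [hr]; field_simp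
      _ ≤ κ * ν ^ 3 * Real.sqrt ((2 : ℝ) ^ q) := mul_le_mul_of_nonneg_left h3 hκν.le
  refine ((Hat ν T hν hT u p hmax hLH t₀ ⟨ht₀.1.le, ht₀.2⟩).and_eventually hev).mono ?_
  rintro q ⟨hq, hqev⟩
  -- real constants of the level
  set Pq : ℝ := (2 : ℝ) ^ q with hPq
  set Sq : ℝ := Real.sqrt ((2 : ℝ) ^ q) with hSq
  have hPqpos : 0 < Pq := by positivity
  have hSqpos : 0 < Sq := Real.sqrt_pos.2 hPqpos
  have hSq2 : Sq ^ 2 = Pq := Real.sq_sqrt hPqpos.le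
  -- Step 1: the window sup is bounded by the energy
  set D : ℝ≥0∞ := (CB : ℝ≥0∞) ^ 2 * ((C₁ : ℝ≥0∞) * (2 : ℝ≥0∞) ^ ((q : ℝ) * (3 / 2)) * E₀) with hD
  have hDtop : D ≠ ∞ := ENNReal.mul_ne_top (ENNReal.pow_ne_top ENNReal.coe_ne_top)
    (ENNReal.mul_ne_top (ENNReal.mul_ne_top ENNReal.coe_ne_top
      (ENNReal.rpow_ne_top_of_nonneg (by positivity) ENNReal.ofNat_ne_top)) hE₀top)
  have hDreal : D.toReal = (CB : ℝ) ^ 2 * ((C₁ : ℝ) * (Pq * Sq) * E₀.toReal) := by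
    simp only [hD, ENNReal.toReal_mul, ENNReal.toReal_pow, ENNReal.coe_toReal, toReal_two_rpow_three_halves, hPq, hSq]
  set Tail : ℝ≥0∞ := ∑' n : ℕ, (2 : ℝ≥0∞) ^ (2 * (q + n)) *
    ∫⁻ τ in Ioo t₀ T, blockL2 (u τ) (q + n : ℕ) ^ 2 with hTail
  have hq1 : ENNReal.ofReal (c ^ 3 * ν ^ 2) < D * Tail := by
    refine hq.trans_le ?_
    simp only [hD]
    have hU := hC₁ ν T hν.le u hLH t₀ ht₀.1.le q
    exact mul_le_mul' (mul_le_mul' le_rfl hU) le_rfl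
  -- Step 2: truncate the tail to a finite band
  set f : ℕ → ℝ → ℝ≥0∞ := fun k τ => (2 : ℝ≥0∞) ^ (2 * (q + k)) * blockL2 (u τ) (q + k : ℕ) ^ 2 with hf
  have hfm : ∀ k, ∀ t₁, t₁ ≤ T → AEMeasurable (f k) (volume.restrict (Ioo t₀ t₁)) := by
    intro k t₁ ht₁
    refine AEMeasurable.const_mul ?_ _
    exact ((BlockEnergyContinuity.continuousOn_blockL2_sq hν hT hmax hLH ((q + k : ℕ) : ℤ)).mono
      fun τ hτ => ⟨ht₀.1.trans hτ.1, hτ.2.trans_le ht₁⟩).aemeasurable measurableSet_Ioo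
  have hTail_eq : Tail = ⨆ N : ℕ, ∫⁻ τ in Ioo t₀ T, ∑ k ∈ Finset.range N, f k τ := by
    rw [hTail, ENNReal.tsum_eq_iSup_nat]
    refine iSup_congr fun N => ?_
    rw [lintegral_finsetSum' _ fun k _ => hfm k T le_rfl]
    refine Finset.sum_congr rfl fun k _ => ?_
    rw [lintegral_const_mul' _ _ (ENNReal.pow_ne_top ENNReal.ofNat_ne_top)]
  have hq2 : ∃ N : ℕ, ENNReal.ofReal (c ^ 3 * ν ^ 2) < D * ∫⁻ τ in Ioo t₀ T, ∑ k ∈ Finset.range N, f k τ := by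
    rw [hTail_eq, ENNReal.mul_iSup] at hq1
    exact lt_iSup_iff.1 hq1
  obtain ⟨N, hN⟩ := hq2
  -- Step 3: truncate the window
  have hq3 : ∃ t₁ ∈ Ioo t₀ T, ENNReal.ofReal (c ^ 3 * ν ^ 2) < D * ∫⁻ τ in Ioo t₀ t₁, ∑ k ∈ Finset.range N, f k τ := by
    rw [← lintegral_const_mul' _ _ hDtop] at hN
    obtain ⟨t₁, ht₁, h⟩ := exists_lt_setLIntegral_Ioo_of_lt ht₀.2 hN
    refine ⟨t₁, ht₁, ?_⟩
    rwa [lintegral_const_mul' _ _ hDtop] at h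
  obtain ⟨t₁, ht₁, hNt⟩ := hq3
  have h01 : t₀ ≤ t₁ := ht₁.1.le
  -- Step 4: the truncated tail in real form
  set I : ℕ → ℝ := fun k => ∫ τ in t₀..t₁, (blockL2 (u τ) ((q + k : ℕ) : ℤ) ^ 2).toReal with hI
  have hI0 : ∀ k, 0 ≤ I k := fun k =>
    intervalIntegral.integral_nonneg h01 fun τ _ => ENNReal.toReal_nonneg
  set X : ℝ := ∑ k ∈ Finset.range N, (4 : ℝ) ^ (q + k) * I k with hX
  have hX0 : 0 ≤ X := Finset.sum_nonneg fun k _ => mul_nonneg (by positivity) (hI0 k)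
  have h4 : ∀ m : ℕ, (2 : ℝ≥0∞) ^ (2 * m) = ENNReal.ofReal ((4 : ℝ) ^ m) := fun m => by
    rw [ENNReal.ofReal_pow (by norm_num), ENNReal.ofReal_ofNat, pow_mul]; norm_num
  have htrunc : ∫⁻ τ in Ioo t₀ t₁, ∑ k ∈ Finset.range N, f k τ = ENNReal.ofReal X := by
    rw [lintegral_finsetSum' _ fun k _ => hfm k t₁ ht₁.2.le, hX, ENNReal.ofReal_sum_of_nonneg
      fun k _ => mul_nonneg (by positivity) (hI0 k)]
    refine Finset.sum_congr rfl fun k _ => ?_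
    rw [hf]
    simp only
    rw [lintegral_const_mul' _ _ (ENNReal.pow_ne_top ENNReal.ofNat_ne_top),
      (setLIntegral_blockL2_sq_eq_ofReal hν hT hmax hLH ht₀.1 h01 ht₁.2 ((q + k : ℕ) : ℤ)).1, h4,
      ← ENNReal.ofReal_mul (by positivity)]
  rw [htrunc] at hNt
  have hreal : c ^ 3 * ν ^ 2 < D.toReal * X := by
    have h := ENNReal.toReal_strict_mono (ENNReal.mul_ne_top hDtop ENNReal.ofReal_ne_top) hNt
    rwa [ENNReal.toReal_ofReal (by positivity), ENNReal.toReal_mul, ENNReal.toReal_ofReal hX0] at h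
  rw [hDreal] at hreal
  -- Step 5: the band flux pays rent minus stock (L16 on the band, written over `k < N`)
  set B : Finset ℤ := (Finset.range N).image (fun k : ℕ => ((q + k : ℕ) : ℤ)) with hB
  have hinj : ∀ a ∈ Finset.range N, ∀ b ∈ Finset.range N,
      ((q + a : ℕ) : ℤ) = ((q + b : ℕ) : ℤ) → a = b := fun a _ b _ h => by simpa using h
  obtain ⟨hL16, -⟩ := band_flux_ge hν hT hmax hLH ht₀.1 h01 ht₁.2 B
  rw [hB, Finset.sum_image hinj, Finset.sum_image hinj, Finset.sum_image hinj] at hL16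
  simp only [zpow_natCast] at hL16
  -- `hL16 : ν/(3cr²) * X' - St/2 ≤ flux` with `X' = X`
  set flux : ℝ := -∑ k ∈ Finset.range N, (∫ τ in t₀..t₁,
      ∫ x, ⟪blockFn ((q + k : ℕ) : ℤ) (u τ) x, blockFn ((q + k : ℕ) : ℤ) (convect (u τ) (u τ)) x⟫) with hflux
  set St : ℝ := ∑ k ∈ Finset.range N, (blockL2 (u t₀) ((q + k : ℕ) : ℤ) ^ 2).toReal with hSt
  have hL16' : ν / (3 * cr ^ 2) * X - St / 2 ≤ flux := hL16
  -- Step 6: the stock of the band is small: `4^q St ≤ F`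
  have hstock : Pq ^ 2 * St ≤ F.toReal := by
    have h := four_pow_mul_sum_blockL2_sq_le (u t₀) q N
    have hfin : ∀ k ∈ Finset.range N, blockL2 (u t₀) ((q + k : ℕ) : ℤ) ^ 2 ≠ ∞ := fun k _ =>
      ENNReal.pow_ne_top (((isSmoothL2Field_slice_of_maximal hν hT hmax hLH ht₀).blockFn _).memLp_two.eLpNorm_ne_top)
    have h' := ENNReal.toReal_mono hFtop h
    rw [ENNReal.toReal_mul, ENNReal.toReal_sum hfin, ENNReal.toReal_pow, ENNReal.toReal_ofNat, pow_mul] at h'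
    have hP2 : ((2 : ℝ) ^ 2) ^ q = Pq ^ 2 := by rw [hPq, ← pow_mul, ← pow_mul, mul_comm]
    rw [hP2] at h'
    exact h'
  -- Step 7: the degenerate constants are excluded by the strict inequality
  have hy : c ^ 3 * ν ^ 2 < (CB : ℝ) ^ 2 * (C₁ : ℝ) * (E₀.toReal * (Pq * Sq) * X) := by nlinarith [hreal]
  set e : ℝ := E₀.toReal with he
  have he0 : 0 ≤ e := ENNReal.toReal_nonneg
  set y : ℝ := e * (Pq * Sq) * X with hydef
  have hy0 : 0 ≤ y := by positivity
  have hc3 : 0 < c ^ 3 * ν ^ 2 := by positivity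
  have hC₁pos : 0 < (C₁ : ℝ) := by
    rcases (NNReal.coe_nonneg C₁).eq_or_lt with h | h
    · exfalso; rw [← h] at hy; simp at hy; linarith
    · exact h
  have hcr : cr ≠ 0 := by
    -- if `C_r = 0`, every block of every slice vanishes (reverse Bernstein), so `X = 0`: contradiction
    intro hcr0
    have hCr0 : K.Cr = 0 := by
      have : ((K.Cr : ℝ≥0) : ℝ) = 0 := by rw [← hcrdef]; exact hcr0
      exact_mod_cast this
    have hblk : ∀ τ ∈ Icc t₀ t₁, ∀ l : ℤ, blockL2 (u τ) l = 0 := by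
      intro τ hτ l
      have hw := isSmoothL2Field_slice_of_maximal hν hT hmax hLH ⟨ht₀.1.trans_le hτ.1, hτ.2.trans_lt ht₁.2⟩
      have h := K.reverse l (u τ) hw
      rw [hCr0] at h
      simp only [ENNReal.coe_zero, zero_mul, nonpos_iff_eq_zero] at h
      simpa only [blockL2] using h
    have hX0' : X = 0 := by
      refine Finset.sum_eq_zero fun k _ => ?_
      have hIk : I k = 0 := by
        simp only [hI]
        rw [intervalIntegral.integral_congr (g := fun _ => (0 : ℝ)) fun τ hτ => ?_, intervalIntegral.integral_zero]
        rw [uIcc_of_le h01] at hτ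
        rw [hblk τ hτ]
        simp
      rw [hIk, mul_zero]
    have : y = 0 := by rw [hydef, hX0']; ring
    rw [show (CB : ℝ) ^ 2 * (C₁ : ℝ) * (e * (Pq * Sq) * X) = (CB : ℝ) ^ 2 * (C₁ : ℝ) * y by rw [hydef],
      this, mul_zero] at hy
    linarith
  have hcr2 : 0 < 3 * cr ^ 2 := by positivity
  -- Step 8: real arithmetic
  -- (i) the gain term: `2 κ ν³ ≤ ν y / (3 cr²)`
  have hκc : κ * (6 * (cr ^ 2 + 1) * (CB : ℝ) ^ 2 * ((C₁ : ℝ) + 1)) = c ^ 3 := by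
    rw [hκ]; field_simp
  have h2κ : κ * (6 * cr ^ 2 * (CB : ℝ) ^ 2 * (C₁ : ℝ)) ≤ c ^ 3 := by
    rw [← hκc]
    refine mul_le_mul_of_nonneg_left ?_ hκpos.le
    have h1 : 6 * cr ^ 2 ≤ 6 * (cr ^ 2 + 1) := by linarith
    have h2 : (C₁ : ℝ) ≤ (C₁ : ℝ) + 1 := by linarith
    calc 6 * cr ^ 2 * (CB : ℝ) ^ 2 * (C₁ : ℝ) ≤ 6 * (cr ^ 2 + 1) * (CB : ℝ) ^ 2 * (C₁ : ℝ) := by gcongr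
      _ ≤ 6 * (cr ^ 2 + 1) * (CB : ℝ) ^ 2 * ((C₁ : ℝ) + 1) := by gcongr
  have hgain : 2 * κ * ν ^ 3 * (3 * cr ^ 2) ≤ ν * y := by
    -- `cb² c₁ (ν y) > c³ ν³ ≥ 6 κ cr² cb² c₁ ν³`
    have hA : (CB : ℝ) ^ 2 * (C₁ : ℝ) * (ν * y) > c ^ 3 * ν ^ 3 := by nlinarith [hy, hν]
    have hB : c ^ 3 * ν ^ 3 ≥ κ * (6 * cr ^ 2 * (CB : ℝ) ^ 2 * (C₁ : ℝ)) * ν ^ 3 :=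
      mul_le_mul_of_nonneg_right h2κ (by positivity)
    have hpos : 0 < (CB : ℝ) ^ 2 * (C₁ : ℝ) := by positivity
    have hC : (CB : ℝ) ^ 2 * (C₁ : ℝ) * (2 * κ * ν ^ 3 * (3 * cr ^ 2)) < (CB : ℝ) ^ 2 * (C₁ : ℝ) * (ν * y) := by
      calc (CB : ℝ) ^ 2 * (C₁ : ℝ) * (2 * κ * ν ^ 3 * (3 * cr ^ 2))
          = κ * (6 * cr ^ 2 * (CB : ℝ) ^ 2 * (C₁ : ℝ)) * ν ^ 3 := by ring
        _ ≤ c ^ 3 * ν ^ 3 := hB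
        _ < (CB : ℝ) ^ 2 * (C₁ : ℝ) * (ν * y) := hA
    exact (lt_of_mul_lt_mul_left hC hpos.le).le
  have hgain' : 2 * κ * ν ^ 3 ≤ ν * y / (3 * cr ^ 2) := by
    rw [le_div_iff₀ hcr2]; exact hgain
  -- (ii) the stock term: `e Pq Sq St ≤ κ ν³`
  have hSt0 : 0 ≤ St := Finset.sum_nonneg fun k _ => ENNReal.toReal_nonneg
  have hloss : e * (Pq * Sq) * St ≤ κ * ν ^ 3 := by
    have h1 : e * (Pq * Sq) * St * Pq = e * Sq * (Pq ^ 2 * St) := by ring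
    have h2 : e * Sq * (Pq ^ 2 * St) ≤ e * Sq * F.toReal := mul_le_mul_of_nonneg_left hstock (by positivity)
    have h3 : e * Sq * F.toReal = Sq * Bst := by rw [hBst]; ring
    have h4 : Sq * Bst ≤ Sq * (κ * ν ^ 3 * Sq) := mul_le_mul_of_nonneg_left hqev hSqpos.le
    have h5 : Sq * (κ * ν ^ 3 * Sq) = κ * ν ^ 3 * Pq := by rw [← hSq2]; ring
    have h6 : e * (Pq * Sq) * St * Pq ≤ κ * ν ^ 3 * Pq := by
      rw [h1]; exact (h2.trans (h3.le.trans h4)).trans h5.le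
    exact le_of_mul_le_mul_right h6 hPqpos
  -- (iii) assemble with L16
  refine ⟨N, t₁, ht₁, ?_⟩
  show κ * ν ^ 3 ≤ e * (Pq * Sq) * flux
  have hmul : e * (Pq * Sq) * (ν / (3 * cr ^ 2) * X - St / 2) ≤ e * (Pq * Sq) * flux :=
    mul_le_mul_of_nonneg_left hL16' (by positivity)
  have hexp : e * (Pq * Sq) * (ν / (3 * cr ^ 2) * X - St / 2) =
      ν * y / (3 * cr ^ 2) - e * (Pq * Sq) * St / 2 := by
    rw [hydef]; ring
  rw [hexp] at hmul
  linarith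

/-! ## L16″ — the instantaneous flux must diverge at the blow-up time -/

/-- **L16″ — THE INSTANTANEOUS FORWARD FLUX DIVERGES AT `T`.** With the absolute `κ > 0` of `forward_flux_floor`: for
every maximal smooth solution `(u, p)` on `ℝ³ × [0, T)` (`ν > 0`), Leray–Hopf from `u 0`, and every `t₀ ∈ (0, T)`: at
INFINITELY MANY levels `q` there is a band `{q, …, q+N−1}` whose INSTANTANEOUS band flux
`Π(τ) = −∑_{k<N} N_{q+k}(u(τ))` exceeds, at some time `τ ∈ (t₀, T)`, every
`M < κ ν³ / (‖u(0)‖₂ · 2^{3q/2} · (T − t₀))` — i.e. `sup_{(t₀,T)} Π ≥ κ ν³ 2^{-3q/2} / (‖u₀‖₂ (T − t₀))`: as the window closes on the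
singular time the instantaneous forward flux into the high bands must DIVERGE at least like `(T − t₀)^{-1}` (the flux
analogue of the capacity floor L12‴, `LevelTransferClock.capacity_floor`). Proof: `forward_flux_floor` gives
`∫_{t₀}^{t₁} Π ≥ κν³ 2^{-3q/2}/‖u₀‖₂` with `t₁ < T`; a flux bounded by `M` on `(t₀, T)` integrates to at most `M (t₁ − t₀)`.
Necessity only; against it the atlas's `Π(t)` time series are read. [cite: CheskidovShvydkoy2010, Lemma 3.2 (proof, (8))] -/
theorem exists_bandFlux_gt :
    ∃ κ : ℝ, 0 < κ ∧ ∀ (ν T : ℝ), 0 < ν → 0 < T →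
      ∀ (u : ℝ → EuclideanSpace ℝ (Fin 3) → EuclideanSpace ℝ (Fin 3)) (p : ℝ → EuclideanSpace ℝ (Fin 3) → ℝ),
      IsMaximalSmoothSolution ν 0 u p T → IsLerayHopfOn T ν 0 (u 0) u →
      ∀ t₀ ∈ Ioo 0 T, ∃ᶠ q : ℕ in atTop, ∃ N : ℕ, ∀ M : ℝ,
        M < κ * ν ^ 3 / ((eLpNorm (u 0) 2 volume).toReal * ((2 : ℝ) ^ q * Real.sqrt ((2 : ℝ) ^ q)) * (T - t₀)) →
        ∃ τ ∈ Ioo t₀ T, M < -∑ k ∈ Finset.range N,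
          ∫ x, ⟪blockFn ((q + k : ℕ) : ℤ) (u τ) x, blockFn ((q + k : ℕ) : ℤ) (convect (u τ) (u τ)) x⟫ := by
  obtain ⟨κ, hκ, H⟩ := forward_flux_floor
  refine ⟨κ, hκ, fun ν T hν hT u p hmax hLH t₀ ht₀ => ?_⟩
  refine (H ν T hν hT u p hmax hLH t₀ ht₀).mono fun q ⟨N, t₁, ht₁, hfl⟩ => ⟨N, fun M hM => ?_⟩
  set E : ℝ := (eLpNorm (u 0) 2 volume).toReal with hE
  set P : ℝ := (2 : ℝ) ^ q * Real.sqrt ((2 : ℝ) ^ q) with hP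
  set Fl : ℝ → ℝ := fun τ => -∑ k ∈ Finset.range N,
    ∫ x, ⟪blockFn ((q + k : ℕ) : ℤ) (u τ) x, blockFn ((q + k : ℕ) : ℤ) (convect (u τ) (u τ)) x⟫ with hFl
  have hκν : 0 < κ * ν ^ 3 := by positivity
  have hE0 : 0 ≤ E := ENNReal.toReal_nonneg
  have hP0 : 0 < P := by positivity
  have h01 : t₀ ≤ t₁ := ht₁.1.le
  -- the flux as the time integral of `Fl`
  have hint : ∀ k ∈ Finset.range N, IntervalIntegrable (fun τ =>
      ∫ x, ⟪blockFn ((q + k : ℕ) : ℤ) (u τ) x, blockFn ((q + k : ℕ) : ℤ) (convect (u τ) (u τ)) x⟫) volume t₀ t₁ :=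
    fun k _ => (blockL2_sq_toReal_sub_eq hν hT hmax hLH ht₀.1 h01 ht₁.2 _).1
  have hFlint : IntervalIntegrable Fl volume t₀ t₁ := by
    have h := (IntervalIntegrable.sum (Finset.range N) hint).neg
    refine (intervalIntegrable_congr fun τ _ => ?_).1 h
    simp only [hFl, Pi.neg_apply, Finset.sum_apply]
  have hflux_eq : -∑ k ∈ Finset.range N, (∫ τ in t₀..t₁,
      ∫ x, ⟪blockFn ((q + k : ℕ) : ℤ) (u τ) x, blockFn ((q + k : ℕ) : ℤ) (convect (u τ) (u τ)) x⟫) =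
      ∫ τ in t₀..t₁, Fl τ := by
    rw [hFl, intervalIntegral.integral_neg, intervalIntegral.integral_finsetSum hint]
  rw [hflux_eq] at hfl
  -- `E P > 0` (else `κ ν³ ≤ 0`)
  have hEP : 0 < E * P := by
    rcases (mul_nonneg hE0 hP0.le).eq_or_lt with h | h
    · exfalso; rw [← h, zero_mul] at hfl; linarith
    · exact h
  have hflux_pos : κ * ν ^ 3 / (E * P) ≤ ∫ τ in t₀..t₁, Fl τ := by
    rw [div_le_iff₀ hEP]; linarith
  -- if `Fl ≤ M` on `(t₀, T)` the integral is at most `M (t₁ - t₀)`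
  by_contra hcon
  push Not at hcon
  have hle : ∀ τ ∈ Ioo t₀ t₁, Fl τ ≤ M := fun τ hτ => hcon τ ⟨hτ.1, hτ.2.trans ht₁.2⟩
  have hmono : ∫ τ in t₀..t₁, Fl τ ≤ ∫ _ in t₀..t₁, M :=
    intervalIntegral.integral_mono_on_of_le_Ioo h01 hFlint intervalIntegrable_const hle
  rw [intervalIntegral.integral_const, smul_eq_mul] at hmono
  have hTt : t₁ - t₀ < T - t₀ := by linarith [ht₁.2]
  have hTt0 : 0 < T - t₀ := by linarith [ht₀.2]
  have hq : κ * ν ^ 3 / (E * P) / (T - t₀) = κ * ν ^ 3 / (E * P * (T - t₀)) := by rw [div_div]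
  rw [← hq] at hM
  -- `κν³/(EP) ≤ M (t₁ - t₀) < (κν³/(EP(T-t₀))) (T - t₀) = κν³/(EP)` unless `M < 0`, also absurd
  rcases lt_or_ge M 0 with hM0 | hM0
  · have : (t₁ - t₀) * M ≤ 0 := mul_nonpos_of_nonneg_of_nonpos (by linarith) hM0.le
    have hpos : 0 < κ * ν ^ 3 / (E * P) := div_pos hκν hEP
    linarith
  · have h1 : (t₁ - t₀) * M ≤ (T - t₀) * M := mul_le_mul_of_nonneg_right hTt.le hM0
    have h2 : (T - t₀) * M < (T - t₀) * (κ * ν ^ 3 / (E * P) / (T - t₀)) := mul_lt_mul_of_pos_left hM hTt0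
    have h3 : (T - t₀) * (κ * ν ^ 3 / (E * P) / (T - t₀)) = κ * ν ^ 3 / (E * P) := by
      field_simp
    linarith

end Summit.NavierStokesRegularity.FluidComputer.ForwardFluxFloor

end
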